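import Literature.MathematicalPhysics.QuantumLattice.CentreSymmetryConfinementProofs
import Literature.MathematicalPhysics.QuantumLattice.CentreSymmetryDobrushin
import HarnessLib

/-!
# Chatterjee's perimeter law for Wilson loops (CMP 385 (2021), §12, Lemmas 12.1–12.3): proofs

Sibling proof file of `CentreSymmetry.lean` / `CentreSymmetryConfinementProofs.lean` (same
namespace). It proves, following the printed proofs of S. Chatterjee, *A probabilistic mechanism
for quark confinement*, CMP **385** (2021), §12 (chunks `p0022`–`p0023` of the held text
`paper:arxiv-2006.16229`), the three lemmas by which the proof of Theorem 2.4 removes the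
`C₁ T` term from the exponent:

* **Lemma 12.1** (`norm_integral_sq_le_of_quasiInvariant`): for a probability density bounded
  above and below w.r.t. Haar measure and `f = (linear map) ∘ π`,
  `|∫ f ρ dλ₀|² ≤ (1 − ε)² ∫ |f|² ρ dλ₀`. Rendered abstractly: a probability measure `ν` that is
  quasi-invariant (`∫ g∘T dν ≤ K ∫ g dν` for `g ≥ 0`) under a map `T` with `f∘T = c f`, `c ≠ 1`,
  satisfies `‖∫ f dν‖² ≤ (1 − ‖1−c‖²/(2(K+1))) ∫ ‖f‖² dν`. The printed proof (variance identity
  (12.2), Haar invariance `g' ↦ g₀ g'`, `ρ(g₀g') ≥ (a/b) ρ(g')`, `|w−z|² ≤ 2|w|²+2|z|²`) is followed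
  with `T = (g' ↦ g₀ g')` and `K = b/a`.
* **Lemma 12.2** (`exists_oneLink_contraction`): the conditional expectation of `π(ω_e)` given
  all other links is a matrix of `ℓ²`-operator norm `≤ 1 − ε`, uniformly in the edge and the
  condition: here, for the one-link DLR kernel `γ_{{e}}(· | η)` of the Wilson theory,
  `‖(∫ π(U_e) dγ_{{e}}(η)) v‖² ≤ θ ‖v‖²` with `θ < 1` depending only on `G, β, π, d` (and the
  Wilson action `ρ`). The printed «conditional density bounded above and below by `a, b`» is
  rendered as quasi-invariance of the kernel under `U_e ↦ g₀ U_e` with the explicit constant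
  `K = exp(|β| · 2C · 2(d−1))`, `C = sup |Re tr ρ|` (`integral_comp_mul_left_le_ymSpecification`:
  Haar invariance of the reference measure and the oscillation bound of the boundary Wilson action,
  `abs_wilsonBoundaryAction_sub_le`).
* **Lemma 12.3** (`chatterjee2021_perimeterLaw`, the *perimeter law upper bound*, «unconditional,
  … in complete generality»): `|⟨W_ℓ⟩| ≤ C₁ e^{−C₂(R+T)}` for every rectangular loop with sides
  `R, T ≥ 1` and every DLR state, `C₁, C₂ > 0` depending only on `G, β, π, d` (and `ρ`). Printed
  proof, followed: condition on all links except the `T` links `e₁,…,e_T` of one side; given the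
  rest these are independent (no two share a plaquette) and each has the one-link conditional law
  (tree: `matrixIntegral_prod_eq_prod`, Lemma 3.2's kernel factorisation, with single-link
  blocks), so `⟨W_ℓ⟩' = tr(⟨π(ω_{e₁})⟩'⋯⟨π(ω_{e_T})⟩' · Z)` with `Z` unitary and frozen; the
  operator-norm bookkeeping (12.3)–(12.5) gives `|⟨W_ℓ⟩'| ≤ m² (1−ε)^T` (printed constant `C`;
  here `C = m²` from the entrywise form of (12.5)); the other side is treated by the coordinate
  symmetry of the theory (`map_relabel_edgePerm_mem_ymGibbsMeasures`), and
  `max(R,T) ≥ (R+T)/2`.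

No named fact (`Prop`-valued hypothesis) is introduced; every statement is proved (D-0026).

## References

* S. Chatterjee, *A probabilistic mechanism for quark confinement*, Commun. Math. Phys. **385**
  (2021) 1007–1039, arXiv:2006.16229, §12 (Lemmas 12.1, 12.2, 12.3). [Chatterjee2021]
* H.-O. Georgii, *Gibbs Measures and Phase Transitions*, 2nd ed. (2011), Def. 1.23, Rem. 1.24
  (DLR equations), (1.16)–(1.18) (properness). [Georgii2011]
-/

noncomputable section

open MeasureTheory Filter Topology
open scoped Matrix
open Literature.Probability.LatticeModels

namespace Literature.MathematicalPhysics.QuantumLattice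

/-! ### Lemma 12.1: the variance bound for a quasi-invariant measure -/

section HaarLemma

variable {X : Type*} [MeasurableSpace X]

/-- The variance identity `∫ ‖f − ∫f‖² = ∫ ‖f‖² − ‖∫ f‖²` for a bounded complex observable and a
probability measure (the printed identity (12.2)). [cite: Chatterjee2021, Lemma 12.1 (proof, (12.2))] -/
private theorem integral_norm_sub_integral_sq (ν : Measure X) [IsProbabilityMeasure ν]
    {f : X → ℂ} (hf : Measurable f) {B : ℝ} (hB : ∀ x, ‖f x‖ ≤ B) :
    ∫ x, ‖f x - ∫ y, f y ∂ν‖ ^ 2 ∂ν = ∫ x, ‖f x‖ ^ 2 ∂ν - ‖∫ y, f y ∂ν‖ ^ 2 := by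
  set m : ℂ := ∫ y, f y ∂ν with hm_def
  have hfi : Integrable f ν := Integrable.of_bound hf.aestronglyMeasurable B (ae_of_all _ hB)
  have h2i : Integrable (fun x => ‖f x‖ ^ 2) ν :=
    Integrable.of_bound (hf.norm.pow_const 2).aestronglyMeasurable (B ^ 2)
      (ae_of_all _ fun x => by
        rw [Real.norm_of_nonneg (by positivity)]
        exact pow_le_pow_left₀ (norm_nonneg _) (hB x) 2)
  have hii : Integrable (fun x => inner ℝ (f x) m) ν := hfi.inner_const m
  have hexp : ∀ x, ‖f x - m‖ ^ 2 = ‖f x‖ ^ 2 - 2 * inner ℝ (f x) m + ‖m‖ ^ 2 :=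
    fun x => norm_sub_sq_real (f x) m
  have hinner : ∫ x, inner ℝ (f x) m ∂ν = ‖m‖ ^ 2 := by
    have h : ∀ x, inner ℝ (f x) m = inner ℝ m (f x) := fun x => real_inner_comm _ _
    simp_rw [h]
    rw [integral_inner hfi m, real_inner_self_eq_norm_sq]
  simp_rw [hexp]
  rw [integral_add _ (integrable_const _), integral_sub h2i (hii.const_mul 2), integral_const_mul,
    hinner, integral_const]
  · simp
    ring
  · exact h2i.sub (hii.const_mul 2)

/-- **Chatterjee 2021, Lemma 12.1** (abstract form). Let `ν` be a probability measure which is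
quasi-invariant under a map `T` in the sense `∫ g∘T dν ≤ K ∫ g dν` for bounded measurable
`g ≥ 0` (printed: `ρ dλ₀` with `a ≤ ρ ≤ b`, `T = (g ↦ g₀ g)`, `K = b/a`, by the invariance of Haar
measure and `ρ(g₀ g') ≥ a ≥ (a/b) ρ(g')`), and let `f` be a bounded measurable complex observable
with `f∘T = c·f` (printed: `f` is a linear function of `π(g)` and `π(g₀) = c I` by Schur's lemma).
Then `‖∫ f dν‖² ≤ (1 − ‖1 − c‖²/(2(K+1))) ∫ ‖f‖² dν` — the printed `(1 − ε)²` with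
`ε` depending only on `c` and `K`. Proof as printed: the variance identity (12.2),
`‖1 − c‖² ‖f‖² = ‖f∘T − f‖² ≤ 2‖f∘T − ∫f‖² + 2‖f − ∫f‖²`, and quasi-invariance applied to
`g = ‖f − ∫ f‖²`. [cite: Chatterjee2021, Lemma 12.1] -/
theorem norm_integral_sq_le_of_quasiInvariant (ν : Measure X) [IsProbabilityMeasure ν]
    {T : X → X} {K : ℝ} (hK : 0 ≤ K)
    (hdom : ∀ (g : X → ℝ) (B : ℝ), Measurable g → (∀ x, 0 ≤ g x) → (∀ x, g x ≤ B) →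
      ∫ x, g (T x) ∂ν ≤ K * ∫ x, g x ∂ν)
    {f : X → ℂ} (hf : Measurable f) {B : ℝ} (hB : ∀ x, ‖f x‖ ≤ B) {c : ℂ}
    (hc : ∀ x, f (T x) = c * f x) :
    ‖∫ x, f x ∂ν‖ ^ 2 ≤ (1 - ‖1 - c‖ ^ 2 / (2 * (K + 1))) * ∫ x, ‖f x‖ ^ 2 ∂ν := by
  set m : ℂ := ∫ y, f y ∂ν with hm_def
  set S : ℝ := ∫ x, ‖f x‖ ^ 2 ∂ν with hS_def
  set V : ℝ := ∫ x, ‖f x - m‖ ^ 2 ∂ν with hV_def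
  have hV : V = S - ‖m‖ ^ 2 := integral_norm_sub_integral_sq ν hf hB
  -- the test function `g = ‖f − m‖²`
  have hg_meas : Measurable fun x => ‖f x - m‖ ^ 2 := (hf.sub_const m).norm.pow_const 2
  have hmB : ‖m‖ ≤ B := by
    have h := norm_integral_le_of_norm_le_const (μ := ν) (f := f) (C := B) (ae_of_all ν hB)
    simpa using h
  have hg_bd : ∀ x, ‖f x - m‖ ^ 2 ≤ (2 * B) ^ 2 := fun x => by
    have : ‖f x - m‖ ≤ 2 * B := (norm_sub_le _ _).trans (by linarith [hB x])
    exact pow_le_pow_left₀ (norm_nonneg _) this 2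
  have hdomg := hdom (fun x => ‖f x - m‖ ^ 2) ((2 * B) ^ 2) hg_meas (fun x => by positivity) hg_bd
  -- pointwise: `‖1 − c‖² ‖f x‖² ≤ 2 ‖f (T x) − m‖² + 2 ‖f x − m‖²`
  have hpt : ∀ x, ‖1 - c‖ ^ 2 * ‖f x‖ ^ 2 ≤ 2 * ‖f (T x) - m‖ ^ 2 + 2 * ‖f x - m‖ ^ 2 := by
    intro x
    have h1 : ‖f (T x) - f x‖ = ‖1 - c‖ * ‖f x‖ := by
      rw [hc x, norm_sub_rev (1 : ℂ) c, ← norm_mul]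
      congr 1
      ring
    have h2 : ‖f (T x) - f x‖ ≤ ‖f (T x) - m‖ + ‖f x - m‖ := by
      have := norm_sub_le (f (T x) - m) (f x - m)
      rwa [sub_sub_sub_cancel_right] at this
    have h3 : (‖f (T x) - m‖ + ‖f x - m‖) ^ 2 ≤ 2 * ‖f (T x) - m‖ ^ 2 + 2 * ‖f x - m‖ ^ 2 := by
      nlinarith [sq_nonneg (‖f (T x) - m‖ - ‖f x - m‖)]
    calc ‖1 - c‖ ^ 2 * ‖f x‖ ^ 2 = ‖f (T x) - f x‖ ^ 2 := by rw [h1, mul_pow]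
      _ ≤ (‖f (T x) - m‖ + ‖f x - m‖) ^ 2 := pow_le_pow_left₀ (norm_nonneg _) h2 2
      _ ≤ _ := h3
  -- integrate the pointwise bound
  have hTmeas : Measurable fun x => ‖f (T x) - m‖ ^ 2 := by
    have : (fun x => ‖f (T x) - m‖ ^ 2) = fun x => ‖c * f x - m‖ ^ 2 := funext fun x => by rw [hc]
    rw [this]
    exact ((hf.const_mul c).sub_const m).norm.pow_const 2
  have hcB : ∀ x, ‖f (T x) - m‖ ^ 2 ≤ ((‖c‖ + 1) * B) ^ 2 := fun x => by
    have : ‖f (T x) - m‖ ≤ (‖c‖ + 1) * B := by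
      rw [hc x]
      refine (norm_sub_le _ _).trans ?_
      rw [norm_mul, add_mul, one_mul]
      exact add_le_add (mul_le_mul_of_nonneg_left (hB x) (norm_nonneg _)) hmB
    exact pow_le_pow_left₀ (norm_nonneg _) this 2
  have hTi : Integrable (fun x => ‖f (T x) - m‖ ^ 2) ν :=
    Integrable.of_bound hTmeas.aestronglyMeasurable (((‖c‖ + 1) * B) ^ 2)
      (ae_of_all _ fun x => by rw [Real.norm_of_nonneg (by positivity)]; exact hcB x)
  have hgi : Integrable (fun x => ‖f x - m‖ ^ 2) ν :=
    Integrable.of_bound hg_meas.aestronglyMeasurable ((2 * B) ^ 2)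
      (ae_of_all _ fun x => by rw [Real.norm_of_nonneg (by positivity)]; exact hg_bd x)
  have hSi : Integrable (fun x => ‖f x‖ ^ 2) ν :=
    Integrable.of_bound (hf.norm.pow_const 2).aestronglyMeasurable (B ^ 2)
      (ae_of_all _ fun x => by
        rw [Real.norm_of_nonneg (by positivity)]
        exact pow_le_pow_left₀ (norm_nonneg _) (hB x) 2)
  have hint : ‖1 - c‖ ^ 2 * S ≤ 2 * (∫ x, ‖f (T x) - m‖ ^ 2 ∂ν) + 2 * V := by
    rw [hS_def, hV_def, ← integral_const_mul, ← integral_const_mul, ← integral_const_mul,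
      ← integral_add (hTi.const_mul 2) (hgi.const_mul 2)]
    exact integral_mono (hSi.const_mul _) ((hTi.const_mul 2).add (hgi.const_mul 2)) hpt
  have key : ‖1 - c‖ ^ 2 * S ≤ 2 * (K + 1) * (S - ‖m‖ ^ 2) := by
    rw [← hV]
    nlinarith [hdomg, hint]
  have h2K : 0 < 2 * (K + 1) := by positivity
  rw [show (1 - ‖1 - c‖ ^ 2 / (2 * (K + 1))) * S = S - ‖1 - c‖ ^ 2 * S / (2 * (K + 1)) by ring]
  have : ‖1 - c‖ ^ 2 * S / (2 * (K + 1)) ≤ S - ‖m‖ ^ 2 := by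
    rw [div_le_iff₀ h2K]
    linarith [key]
  linarith

end HaarLemma

/-! ### Lemma 12.2, abstract core: `ℓ²`-contraction of the averaged unitary -/

section MatrixContraction

variable {m : ℕ}

/-- `‖U v‖₂ = ‖v‖₂` for a unitary matrix (the printed «since `π(ω_e)` is a unitary matrix,
`‖π(ω_e) x‖ = ‖x‖`»). [cite: Chatterjee2021, Lemma 12.2 (proof)] -/
theorem sum_norm_sq_unitary_mulVec {U : Matrix (Fin m) (Fin m) ℂ}
    (hU : U ∈ Matrix.unitaryGroup (Fin m) ℂ) (v : Fin m → ℂ) :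
    ∑ a, ‖(U *ᵥ v) a‖ ^ 2 = ∑ a, ‖v a‖ ^ 2 := by
  have key : ∀ w : Fin m → ℂ, ((∑ a, ‖w a‖ ^ 2 : ℝ) : ℂ) = star w ⬝ᵥ w := fun w => by
    simp only [dotProduct, Pi.star_apply, Complex.star_def, Complex.conj_mul', Complex.ofReal_sum,
      Complex.ofReal_pow]
  have h : star (U *ᵥ v) ⬝ᵥ (U *ᵥ v) = star v ⬝ᵥ v := by
    rw [Matrix.star_mulVec, ← Matrix.star_eq_conjTranspose, Matrix.dotProduct_mulVec,
      Matrix.vecMul_vecMul, Matrix.mem_unitaryGroup_iff'.1 hU, Matrix.vecMul_one]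
  exact_mod_cast (key (U *ᵥ v)).trans (h.trans (key v).symm)

variable {X : Type*} [MeasurableSpace X]

/-- **Chatterjee 2021, Lemma 12.2** (abstract core). For a probability measure `ν` quasi-invariant
under `T` (constant `K`) and a measurable unitary-valued `Φ` with `Φ∘T = c·Φ`, the averaged matrix
`∫ Φ dν` is an `ℓ²`-contraction by the factor `1 − ‖1−c‖²/(2(K+1))` (on squared norms): the
printed «each component of `π(ω_e) x` is a linear function of `π(ω_e)`», Lemma 12.1 for each
component, and `‖π(ω_e) x‖ = ‖x‖` (measurability of `Φ` is entrywise, `Matrix` carrying no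
measurable structure). [cite: Chatterjee2021, Lemma 12.2] -/
theorem sum_norm_sq_matrixIntegral_mulVec_le (ν : Measure X) [IsProbabilityMeasure ν]
    {T : X → X} {K : ℝ} (hK : 0 ≤ K)
    (hdom : ∀ (g : X → ℝ) (B : ℝ), Measurable g → (∀ x, 0 ≤ g x) → (∀ x, g x ≤ B) →
      ∫ x, g (T x) ∂ν ≤ K * ∫ x, g x ∂ν)
    {Φ : X → Matrix (Fin m) (Fin m) ℂ} (hΦ : ∀ a b, Measurable fun x => Φ x a b)
    (hΦu : ∀ x, Φ x ∈ Matrix.unitaryGroup (Fin m) ℂ) {c : ℂ} (hc : ∀ x, Φ (T x) = c • Φ x)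
    (v : Fin m → ℂ) :
    ∑ a, ‖(matrixIntegral ν Φ *ᵥ v) a‖ ^ 2 ≤
      (1 - ‖1 - c‖ ^ 2 / (2 * (K + 1))) * ∑ a, ‖v a‖ ^ 2 := by
  set θ : ℝ := 1 - ‖1 - c‖ ^ 2 / (2 * (K + 1)) with hθ
  have hent1 : ∀ x a b, ‖Φ x a b‖ ≤ 1 := fun x => entry_norm_bound_of_unitary (hΦu x)
  have hB : ∀ x a, ‖(Φ x *ᵥ v) a‖ ≤ ∑ b, ‖v b‖ := fun x a => by
    simp only [Matrix.mulVec, dotProduct]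
    calc ‖∑ b, Φ x a b * v b‖ ≤ ∑ b, ‖Φ x a b * v b‖ := norm_sum_le _ _
      _ ≤ ∑ b, ‖v b‖ := Finset.sum_le_sum fun b _ => by
          rw [norm_mul]
          exact mul_le_of_le_one_left (norm_nonneg _) (hent1 x a b)
  have hmeas : ∀ a, Measurable fun x => (Φ x *ᵥ v) a := fun a => by
    simp only [Matrix.mulVec, dotProduct]
    exact Finset.measurable_sum _ fun b _ => (hΦ a b).mul_const _
  have hequiv : ∀ a x, (Φ (T x) *ᵥ v) a = c * (Φ x *ᵥ v) a := fun a x => by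
    rw [hc x, Matrix.smul_mulVec, Pi.smul_apply, smul_eq_mul]
  have hinti : ∀ a b, Integrable (fun x => Φ x a b) ν := fun a b =>
    Integrable.of_bound (hΦ a b).aestronglyMeasurable 1
      (ae_of_all _ fun x => hent1 x a b)
  have hentry : ∀ a, (matrixIntegral ν Φ *ᵥ v) a = ∫ x, (Φ x *ᵥ v) a ∂ν := fun a => by
    simp only [Matrix.mulVec, dotProduct, matrixIntegral, Matrix.of_apply]
    rw [integral_finsetSum _ fun b _ => (hinti a b).mul_const _]
    exact Finset.sum_congr rfl fun b _ => (integral_mul_const _ _).symm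
  have h1 : ∀ a, ‖(matrixIntegral ν Φ *ᵥ v) a‖ ^ 2 ≤ θ * ∫ x, ‖(Φ x *ᵥ v) a‖ ^ 2 ∂ν := fun a => by
    rw [hentry]
    exact norm_integral_sq_le_of_quasiInvariant ν hK hdom (hmeas a) (fun x => hB x a) (hequiv a)
  have h2i : ∀ a, Integrable (fun x => ‖(Φ x *ᵥ v) a‖ ^ 2) ν := fun a =>
    Integrable.of_bound ((hmeas a).norm.pow_const 2).aestronglyMeasurable ((∑ b, ‖v b‖) ^ 2)
      (ae_of_all _ fun x => by
        rw [Real.norm_of_nonneg (by positivity)]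
        exact pow_le_pow_left₀ (norm_nonneg _) (hB x a) 2)
  calc ∑ a, ‖(matrixIntegral ν Φ *ᵥ v) a‖ ^ 2
      ≤ ∑ a, θ * ∫ x, ‖(Φ x *ᵥ v) a‖ ^ 2 ∂ν := Finset.sum_le_sum fun a _ => h1 a
    _ = θ * ∫ x, ∑ a, ‖(Φ x *ᵥ v) a‖ ^ 2 ∂ν := by
        rw [← Finset.mul_sum, integral_finsetSum _ fun a _ => h2i a]
    _ = θ * ∑ a, ‖v a‖ ^ 2 := by
        have h3 : ∀ x, ∑ a, ‖(Φ x *ᵥ v) a‖ ^ 2 = ∑ a, ‖v a‖ ^ 2 := fun x =>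
          sum_norm_sq_unitary_mulVec (hΦu x) v
        simp_rw [h3]
        rw [integral_const]
        simp

/-- Products of `ℓ²`-contractions are `ℓ²`-contractions, with the product of the factors (the
printed operator-norm inequality (12.4), `‖AB‖_op ≤ ‖A‖_op ‖B‖_op`). [cite: Chatterjee2021, §12 ((12.4))] -/
theorem sum_norm_sq_list_prod_mulVec_le {θ : ℝ} (hθ : 0 ≤ θ) :
    ∀ (L : List (Matrix (Fin m) (Fin m) ℂ)),
      (∀ M ∈ L, ∀ v : Fin m → ℂ, ∑ a, ‖(M *ᵥ v) a‖ ^ 2 ≤ θ * ∑ a, ‖v a‖ ^ 2) →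
      ∀ v : Fin m → ℂ, ∑ a, ‖(L.prod *ᵥ v) a‖ ^ 2 ≤ θ ^ L.length * ∑ a, ‖v a‖ ^ 2
  | [], _, v => by simp [Matrix.one_mulVec]
  | M :: L, h, v => by
      rw [List.prod_cons, List.length_cons, pow_succ, ← Matrix.mulVec_mulVec]
      have ih := sum_norm_sq_list_prod_mulVec_le hθ L (fun M' hM' => h M' (List.mem_cons_of_mem _ hM'))
        v
      calc ∑ a, ‖(M *ᵥ (L.prod *ᵥ v)) a‖ ^ 2 ≤ θ * ∑ a, ‖(L.prod *ᵥ v) a‖ ^ 2 :=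
            h M List.mem_cons_self _
        _ ≤ θ * (θ ^ L.length * ∑ a, ‖v a‖ ^ 2) := mul_le_mul_of_nonneg_left ih hθ
        _ = θ ^ L.length * θ * ∑ a, ‖v a‖ ^ 2 := by ring

/-- Entries of an `ℓ²`-contraction by `t²` (on squared norms) are bounded by `t` (the printed
`‖AB‖ ≤ ‖A‖_op ‖B‖` with `B` a coordinate vector). [cite: Chatterjee2021, §12 ((12.5), proof)] -/
theorem norm_apply_le_of_contraction {P : Matrix (Fin m) (Fin m) ℂ} {t : ℝ} (ht : 0 ≤ t)
    (h : ∀ v : Fin m → ℂ, ∑ a, ‖(P *ᵥ v) a‖ ^ 2 ≤ t ^ 2 * ∑ a, ‖v a‖ ^ 2) (a b : Fin m) :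
    ‖P a b‖ ≤ t := by
  have h1 := h (Pi.single b 1)
  have hPe : ∀ a', (P *ᵥ Pi.single b (1 : ℂ)) a' = P a' b := fun a' => by
    simp [Matrix.mulVec, dotProduct_single]  -- `∑ j, P a' j * Pi.single b 1 j = P a' b`
  have hsum : ∑ a', ‖(Pi.single b (1 : ℂ) : Fin m → ℂ) a'‖ ^ 2 = 1 := by
    rw [Finset.sum_eq_single b]
    · simp
    · intro a' _ ha'
      simp [Pi.single_eq_of_ne ha']
    · intro hb; exact absurd (Finset.mem_univ b) hb
  simp only [hPe, hsum, mul_one] at h1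
  have h2 : ‖P a b‖ ^ 2 ≤ ∑ a', ‖P a' b‖ ^ 2 :=
    Finset.single_le_sum (f := fun a' => ‖P a' b‖ ^ 2) (fun a' _ => sq_nonneg _) (Finset.mem_univ a)
  exact (pow_le_pow_iff_left₀ (norm_nonneg _) ht two_ne_zero).1 (h2.trans h1)

/-- The trace of a matrix with entries bounded by `x` is bounded by `m·x`. [folklore] -/
private theorem norm_trace_le' {A : Matrix (Fin m) (Fin m) ℂ} {x : ℝ} (hA : ∀ a b, ‖A a b‖ ≤ x) :
    ‖A.trace‖ ≤ m * x := by
  simp only [Matrix.trace, Matrix.diag]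
  calc ‖∑ i, A i i‖ ≤ ∑ i, ‖A i i‖ := norm_sum_le _ _
    _ ≤ ∑ _i : Fin m, x := Finset.sum_le_sum fun i _ => hA i i
    _ = m * x := by simp

/-- Entries of a product of two matrices with entries bounded by `x`, `y` are bounded by `m·x·y`. [folklore] -/
private theorem norm_mul_apply_le' {A B : Matrix (Fin m) (Fin m) ℂ} {x y : ℝ}
    (hA : ∀ a b, ‖A a b‖ ≤ x) (hB : ∀ a b, ‖B a b‖ ≤ y) (a b : Fin m) :
    ‖(A * B) a b‖ ≤ m * (x * y) := by
  rw [Matrix.mul_apply]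
  calc ‖∑ c, A a c * B c b‖ ≤ ∑ c, ‖A a c * B c b‖ := norm_sum_le _ _
    _ ≤ ∑ _c : Fin m, x * y := Finset.sum_le_sum fun c _ => by
        rw [norm_mul]
        exact mul_le_mul (hA a c) (hB c b) (norm_nonneg _) ((norm_nonneg _).trans (hA a c))
    _ = m * (x * y) := by simp

end MatrixContraction

/-! ### Lemma 12.2 for the Wilson theory: the one-link kernels are uniform `ℓ²`-contractions -/

section OneLink

variable {d N : ℕ} {G : Type*} [Group G] [TopologicalSpace G] [IsTopologicalGroup G]
  [CompactSpace G] [SecondCountableTopology G] [MeasurableSpace G] [BorelSpace G]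
  (ρ : G →* Matrix (Fin N) (Fin N) ℂ)

omit [SecondCountableTopology G] in
/-- **Haar invariance of the reference measure of the DLR kernels**: the glued product Haar
measure `(Haar^{⊗Λ} glued with η off Λ)` is invariant under left multiplication by a configuration
`k` supported in `Λ` (the printed «invariance of the Haar measure» under `g' ↦ g₀ g'`).
[cite: Chatterjee2021, Lemma 12.1 (proof, invariance of Haar measure)] -/
theorem map_mul_left_glued_pi_haar (Λ : Finset (ZdEdge d)) (η : LGConfig d G) {k : LGConfig d G}
    (hk : ∀ e ∉ Λ, k e = 1) :
    ((Measure.pi fun _ : ↥Λ => QuantumFieldTheory.haarProbability G).map (glueWith Λ · η)).map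
        (fun U : LGConfig d G => k * U) =
      (Measure.pi fun _ : ↥Λ => QuantumFieldTheory.haarProbability G).map (glueWith Λ · η) := by
  have hT : Measurable fun U : LGConfig d G => k * U := measurable_const_mul _
  have hcomm : (fun U : LGConfig d G => k * U) ∘ (fun u : ↥Λ → G => glueWith Λ u η) =
      (fun u : ↥Λ → G => glueWith Λ u η) ∘ fun u => (fun e : ↥Λ => k e) * u := by
    funext u e
    simp only [Function.comp_apply, Pi.mul_apply]
    by_cases he : e ∈ Λ
    · rw [glueWith_apply_mem _ _ _ he, glueWith_apply_mem _ _ _ he, Pi.mul_apply]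
    · rw [glueWith_apply_not_mem _ _ _ he, glueWith_apply_not_mem _ _ _ he, hk e he, one_mul]
  rw [Measure.map_map hT (measurable_glueWith _ _), hcomm,
    ← Measure.map_map (measurable_glueWith _ _) (measurable_const_mul _),
    (measurePreserving_mul_left_pi Λ _).map_eq]

/-- **Quasi-invariance of the Wilson kernels under left multiplication of links** (the printed
«the conditional probability density (with respect to Haar measure) of `ω_e` given
`{ω_u : u ≠ e}` is bounded above and below by two positive constants `a` and `b`», rendered as the
inequality it is used for): for `k` supported in `Λ` and bounded measurable `g ≥ 0`,
`∫ g(k·U) γ_Λ(dU | η) ≤ exp(|β| · 2C · #plaquettesTouching Λ) · ∫ g dγ_Λ(η)`, where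
`|Re tr ρ| ≤ C`. Proof: the tilt `exp(−β S_Λ)` changes by at most the factor
`exp(|β| · 2C · #plaquettesTouching Λ)` under `U ↦ k·U` (`abs_wilsonBoundaryAction_sub_le`), and
the reference measure is invariant (`map_mul_left_glued_pi_haar`). [cite: Chatterjee2021, Lemma 12.2 (proof)] -/
theorem integral_comp_mul_left_le_ymSpecification (hρ : Continuous ρ) {C : ℝ} (hC0 : 0 ≤ C)
    (hC : ∀ (x : Site d) (i j : Fin d) (U : LGConfig d G), |plaquetteObs ρ x i j U| ≤ C)
    (β : ℝ) (Λ : Finset (ZdEdge d)) (η : LGConfig d G) {k : LGConfig d G} (hk : ∀ e ∉ Λ, k e = 1)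
    {g : LGConfig d G → ℝ} (hgm : Measurable g) (hg0 : ∀ U, 0 ≤ g U) {B : ℝ} (hgB : ∀ U, g U ≤ B) :
    ∫ U, g (k * U) ∂(ymSpecification ρ β Λ η) ≤
      Real.exp (|β| * (2 * C * (plaquettesTouching Λ).card)) *
        ∫ U, g U ∂(ymSpecification ρ β Λ η) := by
  set K₀ : ℝ := Real.exp (|β| * (2 * C * (plaquettesTouching Λ).card)) with hK₀
  set μ₀ : Measure (LGConfig d G) :=
    (Measure.pi fun _ : ↥Λ => QuantumFieldTheory.haarProbability G).map (glueWith Λ · η) with hμ₀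
  set w : LGConfig d G → ℝ := fun U => -β * wilsonBoundaryAction ρ Λ U with hw_def
  haveI : IsProbabilityMeasure μ₀ :=
    Measure.isProbabilityMeasure_map (measurable_glueWith Λ η).aemeasurable
  have hw : Continuous w := continuous_const.mul (continuous_wilsonBoundaryAction ρ hρ Λ)
  have hT : Measurable fun U : LGConfig d G => k * U := measurable_const_mul _
  -- the tilt changes by at most the factor `K₀` under `U ↦ k U`
  have hpt : ∀ U, Real.exp (w U) ≤ K₀ * Real.exp (w (k * U)) := by
    intro U
    rw [hK₀, ← Real.exp_add]
    refine Real.exp_le_exp.2 ?_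
    have hdiff := abs_wilsonBoundaryAction_sub_le ρ hC0 hC Λ Λ (U := U) (U' := k * U)
      fun e he => by rw [Pi.mul_apply, hk e he, one_mul]
    have h1 : w U - w (k * U) ≤ |β| * (2 * C * (plaquettesTouching Λ).card) := by
      simp only [hw_def]
      rw [show -β * wilsonBoundaryAction ρ Λ U - -β * wilsonBoundaryAction ρ Λ (k * U) =
          -β * (wilsonBoundaryAction ρ Λ U - wilsonBoundaryAction ρ Λ (k * U)) by ring]
      calc -β * (wilsonBoundaryAction ρ Λ U - wilsonBoundaryAction ρ Λ (k * U))
          ≤ |-β * (wilsonBoundaryAction ρ Λ U - wilsonBoundaryAction ρ Λ (k * U))| := le_abs_self _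
        _ = |β| * |wilsonBoundaryAction ρ Λ U - wilsonBoundaryAction ρ Λ (k * U)| := by
            rw [abs_mul, abs_neg]
        _ ≤ |β| * (2 * C * (plaquettesTouching Λ).card) :=
            mul_le_mul_of_nonneg_left hdiff (abs_nonneg β)
    linarith
  -- a bound for the tilt
  obtain ⟨Cw, hCw⟩ := exists_bound_of_continuous (Real.continuous_exp.comp hw)
  change ∫ U, g (k * U) ∂(μ₀.tilted w) ≤ K₀ * ∫ U, g U ∂(μ₀.tilted w)
  rw [integral_tilted, integral_tilted]
  set Z : ℝ := ∫ U, Real.exp (w U) ∂μ₀ with hZ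
  have hZ0 : 0 ≤ Z := integral_nonneg fun U => (Real.exp_pos _).le
  set φ : LGConfig d G → ℝ := fun U => Real.exp (w U) / Z * g U with hφ
  have hφm : Measurable φ := ((Real.continuous_exp.comp hw).measurable.div_const _).mul hgm
  have hφB : ∀ U, ‖φ U‖ ≤ Cw / Z * B := fun U => by
    rw [hφ, Real.norm_of_nonneg (mul_nonneg (div_nonneg (Real.exp_pos _).le hZ0) (hg0 U))]
    have h1 : Real.exp (w U) ≤ Cw := (le_abs_self _).trans (hCw U)
    have hCw0 : 0 ≤ Cw := (abs_nonneg _).trans (hCw U)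
    exact mul_le_mul (div_le_div_of_nonneg_right h1 hZ0) (hgB U) (hg0 U) (div_nonneg hCw0 hZ0)
  have hφTi : Integrable (fun U => K₀ * φ (k * U)) μ₀ :=
    (Integrable.of_bound (hφm.comp hT).aestronglyMeasurable (Cw / Z * B)
      (ae_of_all _ fun U => hφB (k * U))).const_mul K₀
  have hinv : ∫ U, φ (k * U) ∂μ₀ = ∫ U, φ U ∂μ₀ := by
    have h := integral_map (μ := μ₀) hT.aemeasurable (f := φ)
      (hφm.aestronglyMeasurable (μ := μ₀.map fun U : LGConfig d G => k * U))
    rw [hμ₀, map_mul_left_glued_pi_haar Λ η hk] at h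
    rw [hμ₀]
    exact h.symm
  calc ∫ U, (Real.exp (w U) / Z) • g (k * U) ∂μ₀
      ≤ ∫ U, K₀ * φ (k * U) ∂μ₀ := by
        refine integral_mono_of_nonneg (ae_of_all _ fun U => ?_) hφTi (ae_of_all _ fun U => ?_)
        · exact smul_nonneg (div_nonneg (Real.exp_pos _).le hZ0) (hg0 _)
        · simp only [hφ, smul_eq_mul]
          calc Real.exp (w U) / Z * g (k * U) ≤ K₀ * Real.exp (w (k * U)) / Z * g (k * U) :=
                mul_le_mul_of_nonneg_right (div_le_div_of_nonneg_right (hpt U) hZ0) (hg0 _)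
            _ = K₀ * (Real.exp (w (k * U)) / Z * g (k * U)) := by ring
    _ = K₀ * ∫ U, φ (k * U) ∂μ₀ := integral_const_mul _ _
    _ = K₀ * ∫ U, φ U ∂μ₀ := by rw [hinv]
    _ = K₀ * ∫ U, (Real.exp (w U) / Z) • g U ∂μ₀ := by
        simp only [hφ, smul_eq_mul]

variable {m : ℕ} (π : G →* Matrix (Fin m) (Fin m) ℂ)

/-- **Chatterjee 2021, Lemma 12.2** (for the Wilson theory). If `π(g₀) = c·1` (Schur's lemma for a
central `g₀` and irreducible `π`), then for EVERY edge `e` and EVERY condition `η` the one-link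
kernel average of `π(U_e)` — the printed «matrix of conditional expectations of the entries of
`π(ω_e)` given `{ω_u : u ≠ e}`», here `∫ π(U_e) γ_{{e}}(dU | η)` — is an `ℓ²`-contraction by the
factor `θ = 1 − ‖1 − c‖²/(2(K+1))` (on squared norms; the printed `(1 − ε)²`), with
`K = exp(|β| · 2C · 2(d−1))`, `C = sup |Re tr ρ|`, depending only on `G, β, π, d` (and `ρ`):
Lemma 12.1 / `sum_norm_sq_matrixIntegral_mulVec_le` for the quasi-invariance of `γ_{{e}}(· | η)`
under `U_e ↦ g₀ U_e` (`integral_comp_mul_left_le_ymSpecification`; at most `2(d−1)` plaquettes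
contain `e`, `card_plaquettesTouching_singleton_le`). [cite: Chatterjee2021, Lemma 12.2] -/
theorem exists_oneLink_contraction (hρ : Continuous ρ) (β : ℝ) (hπ : Continuous π)
    (hπu : ∀ g, π g ∈ Matrix.unitaryGroup (Fin m) ℂ) {g₀ : G} {c : ℂ}
    (hc : π g₀ = c • (1 : Matrix (Fin m) (Fin m) ℂ)) :
    ∃ K : ℝ, 0 ≤ K ∧ ∀ (e : ZdEdge d) (η : LGConfig d G) (v : Fin m → ℂ),
      ∑ a, ‖(matrixIntegral (ymSpecification ρ β {e} η) (fun U => π (U e)) *ᵥ v) a‖ ^ 2 ≤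
        (1 - ‖1 - c‖ ^ 2 / (2 * (K + 1))) * ∑ a, ‖v a‖ ^ 2 := by
  obtain ⟨C, hC0, hC⟩ := exists_forall_abs_plaquetteObs_le (d := d) ρ hρ
  set K : ℝ := Real.exp (|β| * (2 * C * ((2 * (d - 1) : ℕ) : ℝ))) with hK
  refine ⟨K, (Real.exp_pos _).le, fun e η v => ?_⟩
  haveI := isProbabilityMeasure_ymSpecification ρ hρ β {e} η
  set k : LGConfig d G := Function.update 1 e g₀ with hk_def
  have hk : ∀ e' ∉ ({e} : Finset (ZdEdge d)), k e' = 1 := fun e' he' => by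
    rw [hk_def, Function.update_of_ne (fun h => he' (Finset.mem_singleton.2 h)), Pi.one_apply]
  have hKe : Real.exp (|β| * (2 * C * (plaquettesTouching ({e} : Finset (ZdEdge d))).card)) ≤ K := by
    rw [hK]
    refine Real.exp_le_exp.2 (mul_le_mul_of_nonneg_left ?_ (abs_nonneg β))
    refine mul_le_mul_of_nonneg_left ?_ (by positivity)
    exact_mod_cast QuantumFieldTheory.card_plaquettesTouching_singleton_le e
  have hdom : ∀ (g : LGConfig d G → ℝ) (B : ℝ), Measurable g → (∀ U, 0 ≤ g U) → (∀ U, g U ≤ B) →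
      ∫ U, g (k * U) ∂(ymSpecification ρ β {e} η) ≤ K * ∫ U, g U ∂(ymSpecification ρ β {e} η) :=
    fun g B hgm hg0 hgB =>
      (integral_comp_mul_left_le_ymSpecification ρ hρ hC0 hC β {e} η hk hgm hg0 hgB).trans
        (mul_le_mul_of_nonneg_right hKe (integral_nonneg hg0))
  have hΦm : ∀ a b, Measurable fun U : LGConfig d G => π (U e) a b := fun a b =>
    ((continuous_apply b).comp ((continuous_apply a).comp hπ)).measurable.comp
      (measurable_pi_apply e)
  have hΦT : ∀ U : LGConfig d G, π ((k * U) e) = c • π (U e) := fun U => by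
    rw [Pi.mul_apply, hk_def, Function.update_self, map_mul, hc, smul_mul_assoc, one_mul]
  exact sum_norm_sq_matrixIntegral_mulVec_le (ymSpecification ρ β {e} η) (Real.exp_pos _).le hdom
    hΦm (fun U => hπu (U e)) hΦT v

end OneLink

/-! ### Plumbing: entrywise integrals, DLR, the column as a product of links, the collar -/

section Plumbing

variable {m : ℕ} {X : Type*} [MeasurableSpace X]

/-- `∫ F·C = (∫ F)·C` for a constant matrix `C`. [folklore] -/
private theorem matrixIntegral_mul_const' (μ : Measure X) {F : X → Matrix (Fin m) (Fin m) ℂ}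
    (hF : ∀ a b, Integrable (fun x => F x a b) μ) (C : Matrix (Fin m) (Fin m) ℂ) :
    matrixIntegral μ (fun x => F x * C) = matrixIntegral μ F * C := by
  ext a b
  simp only [matrixIntegral, Matrix.of_apply, Matrix.mul_apply]
  rw [integral_finsetSum _ fun c _ => (hF a c).mul_const _]
  exact Finset.sum_congr rfl fun c _ => integral_mul_const _ _

/-- `∫ tr F = tr ∫ F`. [folklore] -/
private theorem integral_trace_eq' (μ : Measure X) {F : X → Matrix (Fin m) (Fin m) ℂ}
    (hF : ∀ a b, Integrable (fun x => F x a b) μ) :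
    ∫ x, (F x).trace ∂μ = (matrixIntegral μ F).trace := by
  simp only [Matrix.trace, Matrix.diag, matrixIntegral, Matrix.of_apply]
  exact integral_finsetSum _ fun i _ => hF i i

/-- Properness: an a.s. frozen matrix factor comes out of the entrywise integral on the right
(Georgii 2011, (1.16)–(1.18)). [cite: Georgii2011, (1.16)–(1.18), Remark 1.20] -/
private theorem matrixIntegral_mul_of_ae_eq' (ν : Measure X) {F W : X → Matrix (Fin m) (Fin m) ℂ}
    (hF : ∀ a b, Integrable (fun U => F U a b) ν) {W₀ : Matrix (Fin m) (Fin m) ℂ}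
    (hW : ∀ᵐ U ∂ν, W U = W₀) :
    matrixIntegral ν (fun U => F U * W U) = matrixIntegral ν F * W₀ := by
  rw [← matrixIntegral_mul_const' ν hF W₀]
  ext a b
  simp only [matrixIntegral, Matrix.of_apply]
  refine integral_congr_ae ?_
  filter_upwards [hW] with U hU
  rw [hU]

open ProbabilityTheory in
/-- DLR equations for vector-valued observables: `∫ (∫ f dγ_Λ(·|η)) dμ(η) = ∫ f dμ` for a Gibbs
measure `μ` (Georgii 2011, Remark 1.24; the printed «the same bound holds for `|⟨W_ℓ⟩|`»).
[cite: Georgii2011, Rem. 1.24] -/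
private theorem integral_integral_eq_vec' {V S E : Type*} [MeasurableSpace S] [NormedAddCommGroup E]
    [NormedSpace ℝ E] {γ : Specification V S} (hγ : IsSpecification γ) {μ : Measure (V → S)}
    (hμ : IsGibbsMeasure γ μ) (Λ : Finset V) {f : (V → S) → E} (hf : Integrable f μ) :
    ∫ η, ∫ σ, f σ ∂(γ Λ η) ∂μ = ∫ σ, f σ ∂μ := by
  let κ : Kernel (V → S) (V → S) := ⟨γ Λ, hγ.measurable_fun Λ⟩
  have hcomp : (κ ∘ₖ Kernel.const Unit μ) () = μ := by
    rw [Kernel.comp_apply, Kernel.const_apply]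
    exact hμ.bind_eq hγ Λ
  have hfi : Integrable f ((κ ∘ₖ Kernel.const Unit μ) ()) := by rwa [hcomp]
  have key := Kernel.integral_comp hfi
  rw [hcomp, Kernel.const_apply] at key
  exact key.symm

variable {d : ℕ} [NeZero d] {G : Type*} [Group G] (π : G →* Matrix (Fin m) (Fin m) ℂ)

/-- The column matrix is the ordered product of its represented links (the printed
`π(ω_{e₁}) ⋯ π(ω_{e_T})`). [cite: Chatterjee2021, Lemma 12.3 (proof)] -/
private theorem colMat_eq_list_prod (U : LGConfig d G) :
    ∀ (n : ℕ) (y : Site d), colMat π U y n =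
      ((List.range n).map fun t : ℕ => π (U (y + Pi.single 0 (t : ℤ), 0))).prod
  | 0, y => by simp
  | n + 1, y => by
      rw [colMat_succ, List.range_succ_eq_map, List.map_cons, List.prod_cons, List.map_map,
        colMat_eq_list_prod U n (y + Pi.single 0 1)]
      congr 1
      · simp
      · congr 1
        refine List.map_congr_left fun t _ => ?_
        have h : y + Pi.single 0 1 + Pi.single (0 : Fin d) (t : ℤ) =
            y + Pi.single 0 ((Nat.succ t : ℕ) : ℤ) := by
          rw [Nat.cast_succ, Pi.single_add]
          abel
        simp only [Function.comp_apply, h]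

omit [NeZero d] [Group G] in
/-- The vertical edges of the plaquette `(z, {i₁ < j₁})` sit at `z` or at `z + e_{j₁}`. [folklore] -/
private theorem fst_eq_or_of_mem_plaquetteEdges [NeZero d] {z : Site d} {i₁ j₁ : Fin d}
    (hij : i₁ < j₁) {e : ZdEdge d}
    (he : e ∈ plaquetteEdges (⟨z, ⟨(i₁, j₁), hij⟩⟩ : ZdPlaquette d)) (h0 : e.2 = 0) :
    e.1 = z ∨ e.1 = z + Pi.single j₁ 1 := by
  have hj₁ : j₁ ≠ 0 := (lt_of_le_of_lt (Fin.zero_le _) hij).ne'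
  simp only [plaquetteEdges, Finset.mem_insert, Finset.mem_singleton] at he
  rcases he with rfl | rfl | rfl | rfl
  · exact Or.inl rfl
  · exact absurd h0 hj₁
  · exact Or.inr rfl
  · exact absurd h0 hj₁

omit [Group G] in
/-- **No two links of a vertical column share a plaquette** (the printed «`ω_{e₁},…,ω_{e_T}` are
independent … because no two of these edges share a common plaquette»): two edges of one
plaquette lying on the column `y + ℕ e₀` coincide. [cite: Chatterjee2021, Lemma 12.3 (proof)] -/
theorem eq_of_mem_plaquetteEdges_of_mem_colEdges {p : ZdPlaquette d} {e e' : ZdEdge d}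
    (he : e ∈ plaquetteEdges p) (he' : e' ∈ plaquetteEdges p) {y : Site d} {n : ℕ}
    (hey : e ∈ colEdges y n) (hey' : e' ∈ colEdges y n) : e' = e := by
  obtain ⟨t, -, rfl⟩ := mem_colEdges.1 hey
  obtain ⟨t', -, rfl⟩ := mem_colEdges.1 hey'
  obtain ⟨z, ⟨⟨i₁, j₁⟩, hij⟩⟩ := p
  have hj₁ : j₁ ≠ 0 := (lt_of_le_of_lt (Fin.zero_le _) hij).ne'
  have h := fst_eq_or_of_mem_plaquetteEdges hij he rfl
  have h' := fst_eq_or_of_mem_plaquetteEdges hij he' rfl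
  dsimp only at h h'
  have key : (y + Pi.single (0 : Fin d) (t' : ℤ) : Site d) j₁ =
      (y + Pi.single (0 : Fin d) (t : ℤ) : Site d) j₁ := by
    simp [Pi.single_eq_of_ne hj₁]
  rcases h with h | h <;> rcases h' with h' | h'
  · exact Prod.ext (h'.trans h.symm) rfl
  · exfalso; rw [h, h'] at key; simp at key
  · exfalso; rw [h, h'] at key; simp at key
  · exact Prod.ext (h'.trans h.symm) rfl

end Plumbing

/-! ### Lemma 12.3: the perimeter law -/

section Perimeter

variable {d N m : ℕ} [NeZero d] {G : Type*} [Group G] [TopologicalSpace G] [IsTopologicalGroup G]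
  [CompactSpace G] [T2Space G] [SecondCountableTopology G] [MeasurableSpace G] [BorelSpace G]
  (ρ : G →* Matrix (Fin N) (Fin N) ℂ) (π : G →* Matrix (Fin m) (Fin m) ℂ)

/-- **Chatterjee 2021, Lemma 12.3 — the conditioning argument.** Let `μ` be a DLR state of the
Wilson theory, `col(U; y, n) = π(U_{e₁})⋯π(U_{e_n})` the represented vertical column of `n` links
above `y`, and `Z` a continuous unitary-valued factor not depending on the column links (frozen
under `γ_{col}(· | η)`). If every one-link kernel average of `π(U_e)` is an `ℓ²`-contraction by
`s²` (Lemma 12.2), then `|∫ tr(col · Z) dμ| ≤ m² sⁿ`. Proof as printed: condition on the links off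
the column (DLR, `integral_integral_eq_vec'`); given them the column links are independent with
the one-link conditional laws — no two of them share a plaquette
(`eq_of_mem_plaquetteEdges_of_mem_colEdges`), so the kernel factorises
(`matrixIntegral_prod_eq_prod`, the tree's form of Lemma 3.2 with single-link blocks) and `Z` is
frozen (properness): `⟨tr(col·Z)⟩' = tr(⟨π(U_{e₁})⟩'⋯⟨π(U_{e_n})⟩' Z)`; the product of the `n`
contractions has entries `≤ sⁿ` ((12.4)–(12.5)) and `Z` has entries `≤ 1`.
[cite: Chatterjee2021, Lemma 12.3 (proof)] -/
theorem norm_integral_trace_colMat_mul_le (hρ : Continuous ρ) (hπ : Continuous π)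
    (hπu : ∀ g, π g ∈ Matrix.unitaryGroup (Fin m) ℂ) (β : ℝ) {s : ℝ} (hs0 : 0 ≤ s)
    (hs : ∀ (e : ZdEdge d) (η : LGConfig d G) (v : Fin m → ℂ),
      ∑ a, ‖(matrixIntegral (ymSpecification ρ β {e} η) (fun U => π (U e)) *ᵥ v) a‖ ^ 2 ≤
        s ^ 2 * ∑ a, ‖v a‖ ^ 2)
    {μ : Measure (LGConfig d G)} (hμ : μ ∈ ymGibbsMeasures ρ β) (y : Site d) (n : ℕ)
    {Z : LGConfig d G → Matrix (Fin m) (Fin m) ℂ} (hZc : Continuous Z)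
    (hZu : ∀ U, Z U ∈ Matrix.unitaryGroup (Fin m) ℂ)
    (hZoff : ∀ U V : LGConfig d G, (∀ e ∉ colEdges y n, U e = V e) → Z U = Z V) :
    ‖∫ U, (colMat π U y n * Z U).trace ∂μ‖ ≤ (m : ℝ) ^ 2 * s ^ n := by
  have hγ := QuantumFieldTheory.isSpecification_ymSpecification_of_t2Space (d := d) ρ hρ β
  haveI : ∀ (Λ' : Finset (ZdEdge d)) (ζ : LGConfig d G),
      IsProbabilityMeasure (ymSpecification ρ β Λ' ζ) := isProbabilityMeasure_ymSpecification ρ hρ β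
  haveI : IsProbabilityMeasure μ := hμ.1
  set Λ := colEdges y n with hΛ
  set eT : ℕ → ZdEdge d := fun t => (y + Pi.single 0 (t : ℤ), (0 : Fin d)) with heT
  set L : List (Finset (ZdEdge d) × (LGConfig d G → Matrix (Fin m) (Fin m) ℂ)) :=
    (List.range n).map fun t => ({eT t}, fun U => π (U (eT t))) with hL
  set W : LGConfig d G → ℂ := fun U => (colMat π U y n * Z U).trace with hW
  have hPB_eq : ∀ U, (L.map fun bk => bk.2 U).prod = colMat π U y n := fun U => by
    rw [colMat_eq_list_prod π U n y]
    simp only [hL, heT, List.map_map]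
    rfl
  -- continuity and bounds
  have hent : ∀ {F : LGConfig d G → Matrix (Fin m) (Fin m) ℂ}, Continuous F →
      ∀ a b, Continuous fun U => F U a b := fun hF a b =>
    (continuous_apply b).comp ((continuous_apply a).comp hF)
  have hcolc : Continuous fun U : LGConfig d G => colMat π U y n := continuous_colMat π hπ n y
  have hcolu : ∀ U : LGConfig d G, colMat π U y n ∈ Matrix.unitaryGroup (Fin m) ℂ := fun U =>
    colMat_mem_unitaryGroup π hπu U n y
  have hWc : Continuous W := (hcolc.matrix_mul hZc).matrix_trace
  have hWbd : ∀ U, ‖W U‖ ≤ m * 1 := fun U =>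
    norm_trace_le' (entry_norm_bound_of_unitary (mul_mem (hcolu U) (hZu U)))
  have hWi : ∀ (ν : Measure (LGConfig d G)) [IsProbabilityMeasure ν], Integrable W ν := fun ν _ =>
    Integrable.of_bound hWc.aestronglyMeasurable _ (ae_of_all _ hWbd)
  -- the hypotheses of the kernel factorisation, for single-link blocks along the column
  have heT_mem : ∀ t, t < n → eT t ∈ Λ := fun t ht => mem_colEdges.2 ⟨t, ht, rfl⟩
  have hsub : ∀ bk ∈ L, bk.1 ⊆ Λ := by
    intro bk hbk
    obtain ⟨t, ht, rfl⟩ := List.mem_map.1 hbk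
    exact Finset.singleton_subset_iff.2 (heT_mem t (List.mem_range.1 ht))
  have hdisj : L.Pairwise (fun bk bk' => Disjoint bk.1 bk'.1) := by
    rw [hL, List.pairwise_map]
    refine List.Pairwise.imp (fun {t t'} htt' => Finset.disjoint_singleton.2 fun h => htt' ?_)
      List.nodup_range
    have h0 := congrArg (fun e : ZdEdge d => e.1 0) h
    simpa [heT] using h0
  have hcol : ∀ bk ∈ L, ∀ e ∈ (plaquettesTouching bk.1).biUnion plaquetteEdges, e ∈ Λ → e ∈ bk.1 := by
    intro bk hbk e he heΛ
    obtain ⟨t, ht, rfl⟩ := List.mem_map.1 hbk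
    obtain ⟨p, hp, hep⟩ := Finset.mem_biUnion.1 he
    have heTp := QuantumFieldTheory.mem_plaquettesTouching_singleton.1 hp
    exact Finset.mem_singleton.2 (eq_of_mem_plaquetteEdges_of_mem_colEdges heTp hep
      (heT_mem t (List.mem_range.1 ht)) heΛ)
  have hcont : ∀ bk ∈ L, Continuous bk.2 := by
    intro bk hbk
    obtain ⟨t, -, rfl⟩ := List.mem_map.1 hbk
    exact hπ.comp (continuous_apply _)
  have hbd : ∀ bk ∈ L, ∀ U a b, ‖bk.2 U a b‖ ≤ 1 := by
    intro bk hbk U a b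
    obtain ⟨t, -, rfl⟩ := List.mem_map.1 hbk
    exact entry_norm_bound_of_unitary (hπu _) a b
  have hsupp : ∀ bk ∈ L, ∀ a b, IsCylinder (fun U => bk.2 U a b) bk.1 := by
    intro bk hbk a b
    obtain ⟨t, -, rfl⟩ := List.mem_map.1 hbk
    intro U V hUV
    simp only
    rw [hUV (eT t) (by simp)]
  -- Step 1: DLR — condition on everything off the column
  have h2 : ∫ U, W U ∂μ = ∫ η, (∫ U, W U ∂(ymSpecification ρ β Λ η)) ∂μ :=
    (integral_integral_eq_vec' hγ hμ Λ (hWi μ)).symm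
  -- Step 2: `Z` is frozen and the column kernel factorises into one-link kernels
  have hZ_frozen : ∀ η, ∀ᵐ U ∂(ymSpecification ρ β Λ η), Z U = Z η := fun η => by
    filter_upwards [hγ.proper Λ η] with U hU
    exact hZoff U η fun e he => hU e he
  have h3 : ∀ η, ∫ U, W U ∂(ymSpecification ρ β Λ η) =
      ((L.map fun bk => matrixIntegral (ymSpecification ρ β bk.1 η) bk.2).prod * Z η).trace := by
    intro η
    have hcolint : ∀ a b, Integrable (fun U => colMat π U y n a b) (ymSpecification ρ β Λ η) :=
      fun a b => Integrable.of_bound (hent hcolc a b).aestronglyMeasurable 1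
        (ae_of_all _ fun U => entry_norm_bound_of_unitary (hcolu U) a b)
    have hprodint : ∀ a b, Integrable (fun U => (colMat π U y n * Z U) a b)
        (ymSpecification ρ β Λ η) := fun a b =>
      Integrable.of_bound (hent (hcolc.matrix_mul hZc) a b).aestronglyMeasurable 1
        (ae_of_all _ fun U => entry_norm_bound_of_unitary (mul_mem (hcolu U) (hZu U)) a b)
    simp only [hW]
    rw [integral_trace_eq' _ hprodint, matrixIntegral_mul_of_ae_eq' _ hcolint (hZ_frozen η),
      ← matrixIntegral_prod_eq_prod ρ hρ β Λ L hsub hdisj hcol hcont hbd hsupp η]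
    simp only [hPB_eq]
  -- Step 3: operator-norm bookkeeping
  have h4 : ∀ η, ‖∫ U, W U ∂(ymSpecification ρ β Λ η)‖ ≤ (m : ℝ) ^ 2 * s ^ n := by
    intro η
    rw [h3 η]
    set P := (L.map fun bk => matrixIntegral (ymSpecification ρ β bk.1 η) bk.2).prod with hP
    have hPc : ∀ v : Fin m → ℂ, ∑ a, ‖(P *ᵥ v) a‖ ^ 2 ≤ (s ^ n) ^ 2 * ∑ a, ‖v a‖ ^ 2 := by
      intro v
      have h := sum_norm_sq_list_prod_mulVec_le (sq_nonneg s)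
        (L.map fun bk => matrixIntegral (ymSpecification ρ β bk.1 η) bk.2) ?_ v
      · have hlen : (L.map fun bk => matrixIntegral (ymSpecification ρ β bk.1 η) bk.2).length = n := by
          simp [hL]
        rwa [hlen, ← pow_mul, mul_comm 2 n, pow_mul] at h
      · intro M hM w
        obtain ⟨bk, hbk, rfl⟩ := List.mem_map.1 hM
        obtain ⟨t, -, rfl⟩ := List.mem_map.1 hbk
        exact hs (eT t) η w
    have hPe : ∀ a b, ‖P a b‖ ≤ s ^ n := norm_apply_le_of_contraction (pow_nonneg hs0 n) hPc
    have hZe : ∀ a b, ‖Z η a b‖ ≤ 1 := entry_norm_bound_of_unitary (hZu η)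
    calc ‖(P * Z η).trace‖ ≤ m * (m * (s ^ n * 1)) := norm_trace_le' (norm_mul_apply_le' hPe hZe)
      _ = (m : ℝ) ^ 2 * s ^ n := by ring
  -- Step 4: integrate the bound
  rw [h2]
  have h5 := norm_integral_le_of_norm_le_const (μ := μ)
    (f := fun η => ∫ U, W U ∂(ymSpecification ρ β Λ η)) (C := (m : ℝ) ^ 2 * s ^ n)
    (ae_of_all _ h4)
  simpa using h5

end Perimeter

/-! ### Assembly: both orientations of the loop, coordinate symmetry, the printed bound -/

section Assembly

variable {d N m : ℕ} [NeZero d] {G : Type*} [Group G] [TopologicalSpace G] [IsTopologicalGroup G]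
  [CompactSpace G] [T2Space G] [SecondCountableTopology G] [MeasurableSpace G] [BorelSpace G]
  (ρ : G →* Matrix (Fin N) (Fin N) ℂ) (π : G →* Matrix (Fin m) (Fin m) ℂ)

omit [NeZero d] [TopologicalSpace G] [IsTopologicalGroup G] [CompactSpace G] [T2Space G]
  [SecondCountableTopology G] [MeasurableSpace G] [BorelSpace G] in
/-- `lineHol` only sees the links along the walk. [folklore] -/
private theorem lineHol_congr' {U V : LGConfig d G} (i : Fin d) :
    ∀ (n : ℕ) (y : Site d),
      (∀ s : ℕ, s < n → U (y + Pi.single i (s : ℤ), i) = V (y + Pi.single i (s : ℤ), i)) →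
        lineHol U i n y = lineHol V i n y
  | 0, _, _ => rfl
  | n + 1, y, h => by
      rw [lineHol_succ, lineHol_succ]
      have h0 := h 0 (Nat.succ_pos n)
      simp only [Nat.cast_zero, Pi.single_zero, add_zero] at h0
      rw [h0, lineHol_congr' i n (y + Pi.single i 1) fun s hs => ?_]
      have := h (s + 1) (Nat.succ_lt_succ hs)
      rwa [Nat.cast_succ, add_comm (s : ℤ) 1, Pi.single_add, ← add_assoc] at this

omit [NeZero d] [CompactSpace G] [T2Space G] [SecondCountableTopology G] [MeasurableSpace G]
  [BorelSpace G] in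
/-- `lineHol` depends continuously on the configuration. [folklore] -/
private theorem continuous_lineHol' (i : Fin d) :
    ∀ (n : ℕ) (y : Site d), Continuous fun U : LGConfig d G => lineHol U i n y
  | 0, y => by simp only [lineHol_zero]; exact continuous_const
  | n + 1, y => by
      simp only [lineHol_succ]
      exact (continuous_apply _).mul (continuous_lineHol' i n _)

omit [NeZero d] [CompactSpace G] [T2Space G] [SecondCountableTopology G] [MeasurableSpace G]
  [BorelSpace G] in
/-- The Wilson loop observable of a rectangle is continuous in the configuration. [folklore] -/
private theorem continuous_trace_rect (hπ : Continuous π) (x : Site d) (i j : Fin d) (R T : ℕ) :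
    Continuous fun U : LGConfig d G => (π (walkHolonomy U (rectWalk x i j R T))).trace := by
  simp only [walkHolonomy_rectWalk]
  refine (hπ.comp ?_).matrix_trace
  exact (((continuous_lineHol' _ R _).mul (continuous_lineHol' _ T _)).mul
    (continuous_lineHol' _ R _).inv).mul (continuous_lineHol' _ T _).inv

omit [NeZero d] [TopologicalSpace G] [IsTopologicalGroup G] [CompactSpace G] [T2Space G]
  [SecondCountableTopology G] [MeasurableSpace G] [BorelSpace G] in
/-- Trace cyclicity for the rectangle: `tr π(A B C⁻¹ D⁻¹) = tr(π(B) π(C⁻¹ D⁻¹ A))`. [folklore] -/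
private theorem trace_map_rect' (A B C D : G) :
    (π (A * B * C⁻¹ * D⁻¹)).trace = (π B * π (C⁻¹ * D⁻¹ * A)).trace := by
  rw [show A * B * C⁻¹ * D⁻¹ = A * (B * (C⁻¹ * D⁻¹)) by group, map_mul, Matrix.trace_mul_comm,
    ← map_mul, show B * (C⁻¹ * D⁻¹) * A = B * (C⁻¹ * D⁻¹ * A) by group, map_mul]

omit [NeZero d] [TopologicalSpace G] [IsTopologicalGroup G] [CompactSpace G] [T2Space G]
  [SecondCountableTopology G] [MeasurableSpace G] [BorelSpace G] in
/-- `π(A B C⁻¹ D⁻¹) = π(A) π(B C⁻¹ D⁻¹)`. [folklore] -/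
private theorem map_rect_fst (A B C D : G) :
    π (A * B * C⁻¹ * D⁻¹) = π A * π (B * C⁻¹ * D⁻¹) := by
  rw [← map_mul]
  congr 1
  group

/-- **Lemma 12.3, loops `rectWalk x i 0 R T` (second side along `e₀`)**: for a DLR state and
`i ≠ 0`, `R ≥ 1`, `|⟨tr π(U_ℓ)⟩| ≤ m² s^T` whenever the one-link kernels are `s²`-contractions —
the printed `|⟨W_ℓ⟩| ≤ C(1−ε)^T`, conditioning on the links off the side of length `T`.
[cite: Chatterjee2021, Lemma 12.3] -/
theorem norm_integral_trace_rect_le_pow_snd (hρ : Continuous ρ) (hπ : Continuous π)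
    (hπu : ∀ g, π g ∈ Matrix.unitaryGroup (Fin m) ℂ) (β : ℝ) {s : ℝ} (hs0 : 0 ≤ s)
    (hs : ∀ (e : ZdEdge d) (η : LGConfig d G) (v : Fin m → ℂ),
      ∑ a, ‖(matrixIntegral (ymSpecification ρ β {e} η) (fun U => π (U e)) *ᵥ v) a‖ ^ 2 ≤
        s ^ 2 * ∑ a, ‖v a‖ ^ 2)
    {μ : Measure (LGConfig d G)} (hμ : μ ∈ ymGibbsMeasures ρ β) (x : Site d) {i : Fin d}
    (hi : i ≠ 0) {R : ℕ} (hR : 1 ≤ R) (T : ℕ) :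
    ‖∫ U, (π (walkHolonomy U (rectWalk x i 0 R T))).trace ∂μ‖ ≤ (m : ℝ) ^ 2 * s ^ T := by
  set c₀ : Site d := x + Pi.single i (R : ℤ) with hc₀
  set Z : LGConfig d G → Matrix (Fin m) (Fin m) ℂ := fun U =>
    π ((lineHol U i R (x + Pi.single 0 (T : ℤ)))⁻¹ * (lineHol U 0 T x)⁻¹ * lineHol U i R x) with hZ
  have hW : ∀ U : LGConfig d G, (π (walkHolonomy U (rectWalk x i 0 R T))).trace =
      (colMat π U c₀ T * Z U).trace := fun U => by
    rw [walkHolonomy_rectWalk, trace_map_rect', map_lineHol_zero]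
  simp_rw [hW]
  have hi' : (0 : Fin d) ≠ i := Ne.symm hi
  refine norm_integral_trace_colMat_mul_le ρ π hρ hπ hπu β hs0 hs hμ c₀ T ?_ (fun U => hπu _) ?_
  · exact hπ.comp ((((continuous_lineHol' i R _).inv).mul (continuous_lineHol' 0 T _).inv).mul
      (continuous_lineHol' i R _))
  · intro U V hUV
    -- links of direction `i ≠ 0`, and the vertical links above `x ≠ c₀`, are off the column
    have hdir : ∀ (z : Site d) (t : ℕ), (z + Pi.single i (t : ℤ), i) ∉ colEdges c₀ T := by
      intro z t h
      obtain ⟨t', -, ht'⟩ := mem_colEdges.1 h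
      exact hi (Prod.ext_iff.1 ht').2
    have hleft : ∀ t : ℕ, (x + Pi.single (0 : Fin d) (t : ℤ), (0 : Fin d)) ∉ colEdges c₀ T := by
      intro t h
      obtain ⟨t', -, ht'⟩ := mem_colEdges.1 h
      have h1 := congrArg (fun e : ZdEdge d => e.1 i) ht'
      simp [hc₀, Pi.single_eq_of_ne hi] at h1
      omega
    have e2 : lineHol U i R (x + Pi.single 0 (T : ℤ)) = lineHol V i R (x + Pi.single 0 (T : ℤ)) :=
      lineHol_congr' i R _ fun t _ => hUV _ (hdir _ t)
    have e3 : lineHol U 0 T x = lineHol V 0 T x := lineHol_congr' 0 T _ fun t _ => hUV _ (hleft t)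
    have e4 : lineHol U i R x = lineHol V i R x := lineHol_congr' i R _ fun t _ => hUV _ (hdir _ t)
    simp only [hZ, e2, e3, e4]

/-- **Lemma 12.3, loops `rectWalk x 0 j R T` (first side along `e₀`)**: for a DLR state and
`j ≠ 0`, `T ≥ 1`, `|⟨tr π(U_ℓ)⟩| ≤ m² s^R` — conditioning on the links off the side of length `R`.
[cite: Chatterjee2021, Lemma 12.3] -/
theorem norm_integral_trace_rect_le_pow_fst (hρ : Continuous ρ) (hπ : Continuous π)
    (hπu : ∀ g, π g ∈ Matrix.unitaryGroup (Fin m) ℂ) (β : ℝ) {s : ℝ} (hs0 : 0 ≤ s)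
    (hs : ∀ (e : ZdEdge d) (η : LGConfig d G) (v : Fin m → ℂ),
      ∑ a, ‖(matrixIntegral (ymSpecification ρ β {e} η) (fun U => π (U e)) *ᵥ v) a‖ ^ 2 ≤
        s ^ 2 * ∑ a, ‖v a‖ ^ 2)
    {μ : Measure (LGConfig d G)} (hμ : μ ∈ ymGibbsMeasures ρ β) (x : Site d) {j : Fin d}
    (hj : j ≠ 0) (R : ℕ) {T : ℕ} (hT : 1 ≤ T) :
    ‖∫ U, (π (walkHolonomy U (rectWalk x 0 j R T))).trace ∂μ‖ ≤ (m : ℝ) ^ 2 * s ^ R := by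
  set Z : LGConfig d G → Matrix (Fin m) (Fin m) ℂ := fun U =>
    π (lineHol U j T (x + Pi.single 0 (R : ℤ)) * (lineHol U 0 R (x + Pi.single j (T : ℤ)))⁻¹ *
      (lineHol U j T x)⁻¹) with hZ
  have hW : ∀ U : LGConfig d G, (π (walkHolonomy U (rectWalk x 0 j R T))).trace =
      (colMat π U x R * Z U).trace := fun U => by
    rw [walkHolonomy_rectWalk, map_rect_fst, map_lineHol_zero]
  simp_rw [hW]
  refine norm_integral_trace_colMat_mul_le ρ π hρ hπ hπu β hs0 hs hμ x R ?_ (fun U => hπu _) ?_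
  · exact hπ.comp ((((continuous_lineHol' j T _).mul (continuous_lineHol' 0 R _).inv)).mul
      (continuous_lineHol' j T _).inv)
  · intro U V hUV
    have hdir : ∀ (z : Site d) (t : ℕ), (z + Pi.single j (t : ℤ), j) ∉ colEdges x R := by
      intro z t h
      obtain ⟨t', -, ht'⟩ := mem_colEdges.1 h
      exact hj (Prod.ext_iff.1 ht').2
    have htop : ∀ t : ℕ,
        (x + Pi.single j (T : ℤ) + Pi.single (0 : Fin d) (t : ℤ), (0 : Fin d)) ∉ colEdges x R := by
      intro t h
      obtain ⟨t', -, ht'⟩ := mem_colEdges.1 h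
      have h1 := congrArg (fun e : ZdEdge d => e.1 j) ht'
      simp [Pi.single_eq_of_ne hj] at h1
      omega
    have e2 : lineHol U j T (x + Pi.single 0 (R : ℤ)) = lineHol V j T (x + Pi.single 0 (R : ℤ)) :=
      lineHol_congr' j T _ fun t _ => hUV _ (hdir _ t)
    have e3 : lineHol U 0 R (x + Pi.single j (T : ℤ)) = lineHol V 0 R (x + Pi.single j (T : ℤ)) :=
      lineHol_congr' 0 R _ fun t _ => hUV _ (htop t)
    have e4 : lineHol U j T x = lineHol V j T x := lineHol_congr' j T _ fun t _ => hUV _ (hdir _ t)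
    simp only [hZ, e2, e3, e4]

/-- **Chatterjee 2021, Lemma 12.3 (perimeter law upper bound)**, verbatim: «For any rectangular
loop `ℓ` with side-lengths `R` and `T`, `|⟨W_ℓ⟩| ≤ C₁ e^{−C₂(R+T)}` for any Gibbs measure of our
lattice gauge theory on `ℤ^d`», where (proof) «`C > 0` and `ε ∈ (0,1)` depend only on `G, β, π`
and `d`» and (preceding paragraph) «the result … is unconditional, showing that the perimeter law
upper bound holds in complete generality». Setting: the lattice Yang–Mills theory on `ℤ^d` with
Wilson action of a continuous representation `ρ` of the compact metrisable group `G`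
(`ymGibbsMeasures ρ β` = its DLR states), `π` a continuous finite-dimensional irreducible unitary
representation acting non-trivially on the centre (§12: «Recall that `π` is a finite-dimensional
irreducible unitary representation of `G` which acts nontrivially on the center of `G`»),
`W_ℓ = tr π(U_ℓ)`, rectangular loops `rectWalk x i j R T` (`i ≠ j`, `R, T ≥ 1`). Proof as
printed: Schur (`π(g₀) = c·1`, `c ≠ 1`), Lemma 12.2 (`exists_oneLink_contraction`), the
conditioning argument for the side along `e₀` (`norm_integral_trace_rect_le_pow_snd/fst`,
giving `m² s^T` and `m² s^R` with `s < 1`), loops in other planes by the coordinate symmetry of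
the theory (`map_relabel_edgePerm_mem_ymGibbsMeasures`, the printed «without loss of generality»),
and `max(R,T) ≥ (R+T)/2`; `C₁ = m²`, `C₂ = −½ log max(s, ½)`. [cite: Chatterjee2021, Lemma 12.3] -/
theorem chatterjee2021_perimeterLaw (hρ : Continuous ρ) (β : ℝ) (hπ : Continuous π)
    (hπu : ∀ g, π g ∈ Matrix.unitaryGroup (Fin m) ℂ)
    (hirr : Literature.Analysis.Convex.SymmetryAdapted.IsIrrep π)
    (hg₀ : ∃ g₀ ∈ Subgroup.center G, π g₀ ≠ 1) :
    ∃ C₁ C₂ : ℝ, 0 < C₁ ∧ 0 < C₂ ∧ ∀ μ ∈ ymGibbsMeasures ρ β,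
      ∀ (x : Site d) (i j : Fin d), i ≠ j → ∀ (R T : ℕ), 1 ≤ R → 1 ≤ T →
        ‖∫ U, (π (walkHolonomy U (rectWalk x i j R T))).trace ∂μ‖ ≤
          C₁ * Real.exp (-(C₂ * ((R : ℝ) + T))) := by
  obtain ⟨g₀, hg₀, hg₀ne⟩ := hg₀
  -- Schur's lemma: `π(g₀) = c • 1` with `c ≠ 1`
  obtain ⟨c, hc⟩ := Literature.Analysis.Convex.SymmetryAdapted.exists_eq_smul_one_of_comm hirr
    (M := π g₀) fun g => by rw [← map_mul, ← map_mul, Subgroup.mem_center_iff.1 hg₀ g]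
  have hc1 : c ≠ 1 := fun h => hg₀ne (by rw [hc, h, one_smul])
  have hm : 1 ≤ m := by
    rcases Nat.eq_zero_or_pos m with h | h
    · subst h; exact absurd (Subsingleton.elim _ _) hg₀ne
    · exact h
  have hmpos : (0 : ℝ) < m := by exact_mod_cast hm
  -- Lemma 12.2: the one-link kernels are uniform contractions
  obtain ⟨K, hK0, hK⟩ := exists_oneLink_contraction ρ π hρ β hπ hπu hc
  set θ : ℝ := 1 - ‖1 - c‖ ^ 2 / (2 * (K + 1)) with hθ
  have hθ1 : θ < 1 := by
    have h1 : 0 < ‖1 - c‖ ^ 2 / (2 * (K + 1)) :=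
      div_pos (pow_pos (norm_pos_iff.2 (sub_ne_zero.2 (Ne.symm hc1))) 2) (by positivity)
    rw [hθ]
    linarith
  set s : ℝ := Real.sqrt (max θ 0) with hs_def
  have hs0 : 0 ≤ s := Real.sqrt_nonneg _
  have hs1 : s < 1 := by
    calc s = Real.sqrt (max θ 0) := hs_def
      _ < Real.sqrt 1 := Real.sqrt_lt_sqrt (le_max_right _ _) (max_lt hθ1 one_pos)
      _ = 1 := Real.sqrt_one
  have hs2 : s ^ 2 = max θ 0 := Real.sq_sqrt (le_max_right _ _)
  have hs : ∀ (e : ZdEdge d) (η : LGConfig d G) (v : Fin m → ℂ),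
      ∑ a, ‖(matrixIntegral (ymSpecification ρ β {e} η) (fun U => π (U e)) *ᵥ v) a‖ ^ 2 ≤
        s ^ 2 * ∑ a, ‖v a‖ ^ 2 := fun e η v =>
    (hK e η v).trans (by
      rw [hs2]
      exact mul_le_mul_of_nonneg_right (le_max_left _ _)
        (Finset.sum_nonneg fun a _ => sq_nonneg _))
  -- the constants
  set s₁ : ℝ := max s (1 / 2) with hs₁
  have hs₁0 : 0 < s₁ := lt_of_lt_of_le one_half_pos (le_max_right _ _)
  have hs₁1 : s₁ < 1 := max_lt hs1 one_half_lt_one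
  have hss₁ : s ≤ s₁ := le_max_left _ _
  have hlog : Real.log s₁ < 0 := Real.log_neg hs₁0 hs₁1
  refine ⟨(m : ℝ) ^ 2, -Real.log s₁ / 2, by positivity, by linarith, ?_⟩
  intro μ hμ x i j hij R T hR hT
  -- decay in `T`: relabel so that the second side is along `e₀`
  have hA : ‖∫ U, (π (walkHolonomy U (rectWalk x i j R T))).trace ∂μ‖ ≤ (m : ℝ) ^ 2 * s ^ T := by
    by_cases hj : j = 0
    · subst hj
      exact norm_integral_trace_rect_le_pow_snd ρ π hρ hπ hπu β hs0 hs hμ x hij hR T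
    · set σ : Equiv.Perm (Fin d) := Equiv.swap (0 : Fin d) j with hσ
      have hσj : σ j = 0 := by rw [hσ, Equiv.swap_apply_right]
      have hσi : σ i ≠ 0 := by
        intro h
        apply hij
        have : i = σ.symm 0 := (Equiv.eq_symm_apply σ).2 h
        rw [this, hσ, Equiv.symm_swap, Equiv.swap_apply_left]
      have hΨ : Measurable (relabelConfig (G := G) (edgePerm σ)) :=
        (relabelConfig (edgePerm σ)).measurable
      have hchange : ∫ U, (π (walkHolonomy U (rectWalk x i j R T))).trace ∂μ =
          ∫ U, (π (walkHolonomy U (rectWalk (sitePerm σ x) (σ i) (σ j) R T))).trace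
            ∂(μ.map (relabelConfig (edgePerm σ))) := by
        rw [integral_map hΨ.aemeasurable (continuous_trace_rect π hπ _ _ _ R T).aestronglyMeasurable]
        simp only [walkHolonomy_relabel_edgePerm_rectWalk]
      rw [hchange, hσj]
      exact norm_integral_trace_rect_le_pow_snd ρ π hρ hπ hπu β hs0 hs
        (map_relabel_edgePerm_mem_ymGibbsMeasures ρ hρ β σ hμ) _ hσi hR T
  -- decay in `R`: relabel so that the first side is along `e₀`
  have hB : ‖∫ U, (π (walkHolonomy U (rectWalk x i j R T))).trace ∂μ‖ ≤ (m : ℝ) ^ 2 * s ^ R := by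
    by_cases hi : i = 0
    · subst hi
      exact norm_integral_trace_rect_le_pow_fst ρ π hρ hπ hπu β hs0 hs hμ x (Ne.symm hij) R hT
    · set σ : Equiv.Perm (Fin d) := Equiv.swap (0 : Fin d) i with hσ
      have hσi : σ i = 0 := by rw [hσ, Equiv.swap_apply_right]
      have hσj : σ j ≠ 0 := by
        intro h
        apply hij
        have : j = σ.symm 0 := (Equiv.eq_symm_apply σ).2 h
        rw [this, hσ, Equiv.symm_swap, Equiv.swap_apply_left]
      have hΨ : Measurable (relabelConfig (G := G) (edgePerm σ)) :=
        (relabelConfig (edgePerm σ)).measurable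
      have hchange : ∫ U, (π (walkHolonomy U (rectWalk x i j R T))).trace ∂μ =
          ∫ U, (π (walkHolonomy U (rectWalk (sitePerm σ x) (σ i) (σ j) R T))).trace
            ∂(μ.map (relabelConfig (edgePerm σ))) := by
        rw [integral_map hΨ.aemeasurable (continuous_trace_rect π hπ _ _ _ R T).aestronglyMeasurable]
        simp only [walkHolonomy_relabel_edgePerm_rectWalk]
      rw [hchange, hσi]
      exact norm_integral_trace_rect_le_pow_fst ρ π hρ hπ hπu β hs0 hs
        (map_relabel_edgePerm_mem_ymGibbsMeasures ρ hρ β σ hμ) _ hσj R hT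
  -- `max(R, T) ≥ (R + T)/2`
  have hmax : ‖∫ U, (π (walkHolonomy U (rectWalk x i j R T))).trace ∂μ‖ ≤
      (m : ℝ) ^ 2 * s₁ ^ max R T := by
    rcases le_total R T with h | h
    · rw [max_eq_right h]
      exact hA.trans (mul_le_mul_of_nonneg_left (pow_le_pow_left₀ hs0 hss₁ T) (by positivity))
    · rw [max_eq_left h]
      exact hB.trans (mul_le_mul_of_nonneg_left (pow_le_pow_left₀ hs0 hss₁ R) (by positivity))
  refine hmax.trans (mul_le_mul_of_nonneg_left ?_ (by positivity))
  have hpow : s₁ ^ max R T = Real.exp ((max R T : ℕ) * Real.log s₁) := by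
    rw [Real.exp_nat_mul, Real.exp_log hs₁0]
  rw [hpow]
  refine Real.exp_le_exp.2 ?_
  have hmaxge : ((R : ℝ) + T) / 2 ≤ ((max R T : ℕ) : ℝ) := by
    rw [Nat.cast_max]
    have h1 : (R : ℝ) ≤ max (R : ℝ) T := le_max_left _ _
    have h2 : (T : ℝ) ≤ max (R : ℝ) T := le_max_right _ _
    linarith
  nlinarith [mul_nonneg (sub_nonneg.2 hmaxge) (neg_nonneg.2 hlog.le)]

end Assembly

end Literature.MathematicalPhysics.QuantumLattice

end
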